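import Mathlib.Algebra.MvPolynomial.PDeriv
import Mathlib.Data.Fin.Tuple.Basic
import HarnessLib

/-!
# The Baur–Strassen derivative inequality, total operation count ("cheap gradient")

Topic `Literature/Computability/AlgebraicComplexity`; companion of `NonscalarBaurStrassen.lean`,
which proves the NONSCALAR form `L(f, ∂₁f, …, ∂ₙf) ≤ 3 L(f)` (Baur–Strassen 1983, Thm. 1 =
Bürgisser–Clausen–Shokrollahi 1997, Thm. (7.7)). This file proves the form in which ALL
operations are counted: a straight-line program of `s` instructions computing `f` yields one of
`≤ 5 s + 2` instructions computing `f` together with all its `n` first-order partial derivatives —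
the cost of the whole gradient is a constant multiple of the cost of the function, independently
of `n` (reverse-mode / adjoint differentiation).

## The model (BCS 1997, Def. (4.2), with `Ω = {+, *} ∪ k ∪ kᶜ`)

* `SLInstr R` — an instruction: `add i j`, `mul i j` (binary arithmetic on two earlier wires),
  `smul c i` (multiplication by the scalar `c : R`), `const c` (load the constant `c`). Wires are
  numbered by `ℕ`: the `n` inputs are the wires `0, …, n - 1` (BCS number them `-n+1, …, 0`),
  instruction `t` of a program writes wire `n + t`; a reference to a wire that is not an input and
  not yet written reads the junk value `0` (total semantics, exactly as for the tree's
  `ArithCircuit.Operand.eval`). No subtraction or division: `R` is any commutative semiring (over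
  a ring, `u - v` is `smul (-1)` followed by `add`).
* `SLProgram.run w n P` — execute the list of instructions `P` on the wire valuation `w : ℕ → A`
  (any commutative `R`-algebra `A`), writing wires `n, n + 1, …`; `SLProgram.inputs x` — the
  valuation with inputs `x : Fin n → A` and junk `0`; `SLProgram.wirePoly n P m ∈ R[X₀, …, X_{n-1}]`
  — the polynomial carried by wire `m` after running `P` on the coordinate inputs (`xin`).
* Cost = number of instructions (`List.length`), i.e. the `c`-length of BCS Def. (4.6) for
  `c ≡ 1`: BCS's total length (`tot = 1_{k ∪ {+,-,*,/}}`, Def. (4.7)) plus one unit per `const`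
  instruction — BCS's `tot` does not charge for constants `λᶜ`.

## Main statement

`SLProgram.exists_gradient_program`: for every program `P` on `n` inputs and every wire `m` there
are a program `D` with `D.length ≤ 5 * P.length + 2` and wires `out`, `dout i` (`i : Fin n`), all
`< n + D.length` (inputs or written wires), with `wirePoly n D out = wirePoly n P m` and
`wirePoly n D (dout i) = pderiv i (wirePoly n P m)`.

## The result in print

* Baur–Strassen 1983, Thm. 1: `L(f, ∂f/∂x₁, …, ∂f/∂xₙ) ≤ 3 L(f)` for the nonscalar complexity `L`
  (multiplications/divisions counted, linear operations free) — in the tree as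
  `NonscalarBaurStrassen.lean`; p. 318: "inequalities similar to (1) hold for other cost measures
  (e.g. when counting all operations)".
* Baur–Strassen 1983, Thm. 2, as restated in BCS 1997, §7.5 Notes: if `f ∈ k(X)` is computable
  from `{X₁, …, Xₙ} ∪ k` using `A` additions/subtractions, `S` scalar multiplications and `M`
  further multiplications/divisions, then `{f, ∂₁f, …, ∂ₙf}` is computable using `2A + M`
  additions/subtractions, `2S` scalar multiplications and `3M` multiplications/divisions; in
  particular `L^tot(f, ∂₁f, …, ∂ₙf) ≤ 4 L^tot(f)`. BCS 1997, Thm. (7.7) (nonscalar, factor 3) and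
  Rem. (7.8)(1) (total complexity, factor 4).
* Morgenstern 1985: the inductive proof that deletes the FIRST instruction and treats its result as
  a new input variable; BCS's proof of (7.7) "has been modeled after Morgenstern's proof"
  (§7.5 Notes). This is the architecture followed here.
* Griewank–Walther 2008, §3.3, (3.14): `TIME{F(x), ȳᵀF′(x)} ≤ ω_grad · TIME{F(x)}`,
  `ω_grad ∈ [3, 4]` — the "cheap gradient principle" of algorithmic differentiation.

## What is proved here, and what is not

The constant proved here is `5` (`+ 2`), WEAKER than the printed `4 L^tot`: the peeling induction
is charged, per instruction of `P`, the instruction itself plus `0` (`const`), `2` (`smul`: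
one `smul`, one `add`), `2` (`add`: two `add`) or `≤ 4` (`mul`: two `mul`, two `add`) correction
instructions implementing the chain rule; Baur–Strassen's sharper count saves one addition per
instruction by seeding every adjoint with its first contribution, a bookkeeping this induction does
not carry. The `+ 2` loads the constants `0` and `1` (the derivatives of an input or junk wire when
`P = []`); in BS83/BCS constants are free (`tot(λᶜ) = 0`). NOT covered: division (BS83 and BCS
(7.7) work in a localization of `k[X]`); the translation to the tree's `ArithCircuit.IsFanInTwo` /
`complexity` (weighted sum gates `c • u + d • v`, inline constant and variable operands), which is
linear-size in each direction but not carried out here; higher derivatives (BCS Rem. (7.8)(2)).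

## Proof (BCS 1997, proof of Thm. (7.7), after Morgenstern 1985)

Induction on `P = ins :: E`, with `n` and `m` generalized.
1. `wirePoly_cons` (BCS: the program `Γ′` expecting inputs of length `n + 1`, and the substitution
   `σ : X₀ ↦ r₁`): `wirePoly n (ins :: E) m = (wirePoly (n+1) E m)[X_n ↦ g]`, `g` the value of
   `ins` on the inputs — from `map_run` (program semantics commutes with `R`-algebra maps; BCS,
   proof of Prop. (7.6)) and `update_inputs_eq_inputs_snoc`.
2. The induction hypothesis for `E` on `n + 1` inputs gives `D′` (`≤ 5 |E| + 2` instructions)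
   computing `F = wirePoly (n+1) E m` and `∂₀F, …, ∂ₙF`; by `wirePoly_cons` again, `ins :: D′` on
   `n` inputs computes `σ(F) = f` and all `σ(∂ⱼF)`.
3. Chain rule (`pderiv_aeval_eq_sum`, `pderiv_xin`): `∂ᵢf = σ(∂ᵢF) + σ(∂ₙF) · ∂ᵢg`.
4. Case analysis on `ins` (`∂ᵢg` is `0`, the scalar `c · [a = i]`, `[a = i] + [b = i]`, or
   `X_b [a = i] + X_a [b = i]`; a `mul` with a junk operand computes `0`): append the `≤ 4`
   correction instructions listed above (`wirePoly_gate` evaluates each appended instruction,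
   `wirePoly_append_of_lt` keeps the earlier wires).

## References

* [BaurStrassen1983] W. Baur, V. Strassen, *The complexity of partial derivatives*, Theoret.
  Comput. Sci. 22 (1983) 317–330, Thms. 1, 2.
* [BurgisserClausenShokrollahi1997] P. Bürgisser, M. Clausen, M. A. Shokrollahi, *Algebraic
  Complexity Theory*, Springer 1997: Def. (4.2) (straight-line programs), Thm. (7.7) (derivative
  inequality) and its proof, Rem. (7.8), §7.5 Notes.
* [Morgenstern1985] J. Morgenstern, *How to compute fast a function and all its derivatives: a
  variation on the theorem of Baur–Strassen*, SIGACT News 16(4) (1985) 60–62.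
* [GriewankWalther2008] A. Griewank, A. Walther, *Evaluating Derivatives*, 2nd ed., SIAM 2008,
  §3.3, (3.14) (cheap gradient principle).
-/

noncomputable section

open MvPolynomial

namespace Literature.Computability.AlgebraicComplexity

universe u v

/-- An instruction of a straight-line program with binary arithmetic over the scalars `R`:
wires are numbered by `ℕ` (the `n` inputs are wires `0, …, n-1`, instruction number `t` writes
wire `n + t`), and an instruction adds or multiplies two earlier wires, multiplies a wire by a
scalar, or loads a scalar constant — Bürgisser–Clausen–Shokrollahi 1997, Def. (4.2)(1) with
`Ω = {+, *} ∪ k ∪ kᶜ` and the indices shifted to start at `0`.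
[cite: BurgisserClausenShokrollahi1997, Def. (4.2)] -/
inductive SLInstr (R : Type u) : Type u
  /-- `w_new := w_i + w_j` -/
  | add (i j : ℕ) : SLInstr R
  /-- `w_new := w_i * w_j` -/
  | mul (i j : ℕ) : SLInstr R
  /-- `w_new := c • w_i` (scalar multiplication) -/
  | smul (c : R) (i : ℕ) : SLInstr R
  /-- `w_new := c` (constant) -/
  | const (c : R) : SLInstr R

namespace SLInstr

variable {R : Type u} [CommSemiring R]
variable {A : Type v} [CommSemiring A] [Algebra R A]

/-- The value written by an instruction, given the values `w` of all wires (total semantics: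
`w` is defined on every index; BCS Def. (4.2)(2), `b_i = ω_i(b_{u_{i1}}, b_{u_{i2}})`).
[cite: BurgisserClausenShokrollahi1997, Def. (4.2)] -/
def eval (w : ℕ → A) : SLInstr R → A
  | add i j => w i + w j
  | mul i j => w i * w j
  | smul c i => c • w i
  | const c => algebraMap R A c

/-- Instruction semantics commutes with `R`-algebra homomorphisms (BCS Rem. (4.4): the result
sequence on the input `φ ∘ a` is `φ ∘ b`). [cite: BurgisserClausenShokrollahi1997, Rem. (4.4)] -/
theorem map_eval {B : Type*} [CommSemiring B] [Algebra R B] (φ : A →ₐ[R] B) (w : ℕ → A)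
    (ins : SLInstr R) : φ (ins.eval w) = ins.eval (φ ∘ w) := by
  cases ins <;> simp [eval, map_add, map_mul, map_smul, AlgHom.commutes]

end SLInstr

namespace SLProgram

variable {R : Type u} [CommSemiring R]
variable {A : Type v} [CommSemiring A] [Algebra R A]

/-- Run a straight-line program (a list of instructions) whose first instruction writes wire `n`:
the wire valuation `w : ℕ → A` (inputs and junk) is successively updated at `n, n+1, …`; the result
is the final valuation of ALL wires — the "result sequence" of BCS Def. (4.2)(2), extended by junk.
[cite: BurgisserClausenShokrollahi1997, Def. (4.2)] -/
def run : (ℕ → A) → ℕ → List (SLInstr R) → ℕ → A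
  | w, _, [] => w
  | w, n, ins :: P => run (Function.update w n (ins.eval w)) (n + 1) P

omit [Algebra R A] in
/-- The input valuation of `x : Fin n → A`: wire `k < n` carries `x k`, every other wire the junk
value `0`. [folklore] -/
def inputs {n : ℕ} (x : Fin n → A) : ℕ → A := fun k => if h : k < n then x ⟨k, h⟩ else 0

/-- The polynomial in the `n` input variables carried by wire `m` after running `P` on the input
`(R[X]; X₀, …, X_{n-1})` (wires `m < n` carry `X m`; unreached wires carry `0`) — BCS Def. (4.2)(3):
`P` computes every `wirePoly n P m`. [cite: BurgisserClausenShokrollahi1997, Def. (4.2)] -/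
def wirePoly (n : ℕ) (P : List (SLInstr R)) (m : ℕ) : MvPolynomial (Fin n) R :=
  run (inputs (fun i : Fin n => (X i : MvPolynomial (Fin n) R))) n P m

/-- The empty program leaves every wire unchanged (BCS Def. (4.2)(2), `r = 0`).
[cite: BurgisserClausenShokrollahi1997, Def. (4.2)] -/
@[simp] theorem run_nil (w : ℕ → A) (n : ℕ) : run w n ([] : List (SLInstr R)) = w := rfl

/-- One step of execution: write the first instruction's value to wire `n`, continue at `n + 1`
(BCS Def. (4.2)(2)). [cite: BurgisserClausenShokrollahi1997, Def. (4.2)] -/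
@[simp] theorem run_cons (w : ℕ → A) (n : ℕ) (ins : SLInstr R) (P : List (SLInstr R)) :
    run w n (ins :: P) = run (Function.update w n (ins.eval w)) (n + 1) P := rfl

/-- Running a program never changes wires below its first written index (BCS Def. (4.2)(2): the
result sequence extends the input). [cite: BurgisserClausenShokrollahi1997, Def. (4.2)] -/
theorem run_of_lt (w : ℕ → A) (n : ℕ) (P : List (SLInstr R)) {m : ℕ} (hm : m < n) :
    run w n P m = w m := by
  induction P generalizing w n with
  | nil => rfl
  | cons ins P ih =>
    rw [run_cons, ih _ _ (Nat.lt_succ_of_lt hm), Function.update_of_ne (Nat.ne_of_lt hm)]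

/-- Running a concatenation = running the second part on the wires left by the first (BCS
Def. (4.3), the concatenation `ΓΓ′` with `Γ′` expecting inputs of length `n + r`).
[cite: BurgisserClausenShokrollahi1997, Def. (4.3)] -/
theorem run_append (w : ℕ → A) (n : ℕ) (P E : List (SLInstr R)) :
    run w n (P ++ E) = run (run w n P) (n + P.length) E := by
  induction P generalizing w n with
  | nil => simp
  | cons ins P ih =>
    simp only [List.cons_append, run_cons, ih, List.length_cons]
    congr 1
    omega

/-- Appending instructions does not change the wires already written (BCS Def. (4.3)).
[cite: BurgisserClausenShokrollahi1997, Def. (4.3)] -/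
theorem run_append_of_lt (w : ℕ → A) (n : ℕ) (P E : List (SLInstr R)) {m : ℕ}
    (hm : m < n + P.length) : run w n (P ++ E) m = run w n P m := by
  rw [run_append, run_of_lt _ _ _ hm]

/-- The wire written by an appended instruction carries that instruction's value on the wires of
the program so far (BCS Def. (4.3) with `t = 1`). [cite: BurgisserClausenShokrollahi1997, Def. (4.3)] -/
theorem run_append_single (w : ℕ → A) (n : ℕ) (P : List (SLInstr R)) (ins : SLInstr R) :
    run w n (P ++ [ins]) (n + P.length) = ins.eval (run w n P) := by
  rw [run_append, run_cons, run_nil, Function.update_self]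

/-- Program semantics commutes with `R`-algebra homomorphisms: BCS Rem. (4.4), the result
sequence of `Γ` on `(A′; φ ∘ a)` is `φ ∘ b`. [cite: BurgisserClausenShokrollahi1997, Rem. (4.4)] -/
theorem map_run {B : Type*} [CommSemiring B] [Algebra R B] (φ : A →ₐ[R] B) (w : ℕ → A) (n : ℕ)
    (P : List (SLInstr R)) (m : ℕ) : φ (run w n P m) = run (φ ∘ w) n P m := by
  induction P generalizing w n with
  | nil => rfl
  | cons ins P ih =>
    rw [run_cons, run_cons, ih, Function.comp_update, SLInstr.map_eval]

omit [Algebra R A] in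
/-- Extending the inputs by the value of a new wire `n` is the input valuation of `Fin.snoc`.
[folklore] -/
private theorem update_inputs_eq_inputs_snoc {n : ℕ} (x : Fin n → A) (v : A) :
    Function.update (inputs x) n v = inputs (Fin.snoc x v) := by
  funext k
  rcases Nat.lt_trichotomy k n with hk | rfl | hk
  · rw [Function.update_of_ne (Nat.ne_of_lt hk)]
    simp only [inputs, dif_pos hk, dif_pos (Nat.lt_succ_of_lt hk)]
    have : (⟨k, Nat.lt_succ_of_lt hk⟩ : Fin (n + 1)) = Fin.castSucc ⟨k, hk⟩ := rfl
    rw [this, Fin.snoc_castSucc]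
  · rw [Function.update_self]
    simp only [inputs, dif_pos (Nat.lt_succ_self k)]
    have : (⟨k, Nat.lt_succ_self k⟩ : Fin (k + 1)) = Fin.last k := rfl
    rw [this, Fin.snoc_last]
  · rw [Function.update_of_ne (Nat.ne_of_gt hk)]
    simp only [inputs, dif_neg (Nat.not_lt.mpr (Nat.le_of_lt hk)),
      dif_neg (Nat.not_lt.mpr (Nat.succ_le_of_lt hk))]


section Polynomials

variable (R)

/-- The input valuation by the coordinate polynomials `X 0, …, X (n-1)`. [folklore] -/
abbrev xin (n : ℕ) : ℕ → MvPolynomial (Fin n) R := inputs (fun i : Fin n => (X i : MvPolynomial (Fin n) R))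

variable {R}

/-- Unfolding `wirePoly` through the coordinate input valuation `xin` (BCS Def. (4.2)(2) on the
input `(R[X]; X)`). [cite: BurgisserClausenShokrollahi1997, Def. (4.2)] -/
theorem wirePoly_def (n : ℕ) (P : List (SLInstr R)) (m : ℕ) :
    wirePoly n P m = run (xin R n) n P m := rfl

/-- Input wires carry the coordinate polynomials, junk wires `0` (BCS Def. (4.2)(2), `b_i = a_{n+i}`
for the input positions). [cite: BurgisserClausenShokrollahi1997, Def. (4.2)] -/
theorem wirePoly_of_lt (n : ℕ) (P : List (SLInstr R)) {m : ℕ} (hm : m < n) :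
    wirePoly n P m = X ⟨m, hm⟩ := by
  rw [wirePoly_def, run_of_lt _ _ _ hm]
  simp [inputs, hm]

/-- Appending instructions does not change earlier wires (BCS Def. (4.3)).
[cite: BurgisserClausenShokrollahi1997, Def. (4.3)] -/
theorem wirePoly_append_of_lt (n : ℕ) (P E : List (SLInstr R)) {m : ℕ} (hm : m < n + P.length) :
    wirePoly n (P ++ E) m = wirePoly n P m :=
  run_append_of_lt _ _ _ _ hm

/-- The wire written by an appended instruction (BCS Def. (4.3), `t = 1`).
[cite: BurgisserClausenShokrollahi1997, Def. (4.3)] -/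
theorem wirePoly_append_single (n : ℕ) (P : List (SLInstr R)) (ins : SLInstr R) :
    wirePoly n (P ++ [ins]) (n + P.length) = ins.eval (wirePoly n P) :=
  run_append_single _ _ _ _

/-- **Peeling the first instruction.** Running `ins :: E` on `n` inputs is running `E` on `n + 1`
inputs and then substituting the value `g` of `ins` for the extra variable: wire by wire,
`wirePoly n (ins :: E) m = (wirePoly (n+1) E m)(X₀, …, X_{n-1}, g)`. This is the substitution step
of the Baur–Strassen/Morgenstern induction (BCS: `Γ′` on `n + 1` inputs and `σ : X₀ ↦ r₁`).
[cite: BurgisserClausenShokrollahi1997, proof of Thm. (7.7)] -/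
theorem wirePoly_cons (n : ℕ) (ins : SLInstr R) (E : List (SLInstr R)) (m : ℕ) :
    wirePoly n (ins :: E) m =
      aeval (Fin.snoc (fun i : Fin n => (X i : MvPolynomial (Fin n) R)) (ins.eval (xin R n)))
        (wirePoly (n + 1) E m) := by
  set g := ins.eval (xin R n) with hg
  set φ : Fin (n + 1) → MvPolynomial (Fin n) R := Fin.snoc (fun i : Fin n => X i) g with hφ
  rw [wirePoly_def, run_cons, ← hg]
  change run (Function.update (inputs fun i : Fin n => X i) n g) (n + 1) E m = _
  rw [update_inputs_eq_inputs_snoc, wirePoly_def, map_run]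
  congr 1
  funext k
  simp only [Function.comp_apply, inputs]
  split_ifs with hk
  · rw [aeval_X]
  · rw [map_zero]

/-- **Chain rule for substitution into a polynomial**: for `a : τ → R[σ]` and `p ∈ R[τ]`,
`∂ᵢ (p(a)) = Σₜ (∂ₜ p)(a) · ∂ᵢ aₜ` (induction on `p`; the step "by the chain rule we have
`∂ᵢf = σ(∂ᵢF) + σ(∂₀F)(∂ᵢr₁)`" of BCS's proof of Thm. (7.7); cf. `pderiv_aeval_optionElim` in
`NonscalarBaurStrassen.lean` for the one-extra-variable case).
[cite: BurgisserClausenShokrollahi1997, proof of Thm. (7.7)] -/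
theorem pderiv_aeval_eq_sum {σ τ : Type*} [Fintype τ] (a : τ → MvPolynomial σ R) (i : σ)
    (p : MvPolynomial τ R) :
    pderiv i (aeval a p) = ∑ t, aeval a (pderiv t p) * pderiv i (a t) := by
  classical
  induction p using MvPolynomial.induction_on with
  | C r => simp
  | add p q hp hq => simp only [map_add, hp, hq, add_mul, Finset.sum_add_distrib]
  | mul_X p t₀ hp =>
    have hX : ∀ t, aeval a (pderiv t (X t₀ : MvPolynomial τ R)) =
        if t₀ = t then (1 : MvPolynomial σ R) else 0 := fun t => by
      rw [pderiv_X, Pi.single_apply]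
      split_ifs <;> simp
    simp only [map_mul, aeval_X, Derivation.leibniz, smul_eq_mul, map_add, hp, hX, add_mul,
      Finset.sum_add_distrib]
    congr 1
    · simp only [mul_ite, mul_one, mul_zero, ite_mul, zero_mul, Finset.sum_ite_eq, Finset.mem_univ,
        if_true]
    · rw [Finset.mul_sum]
      exact Finset.sum_congr rfl fun x _ => by ring

/-- Partial derivatives of the input wires: `∂ᵢ (input wire a) = [a = i]`. [folklore] -/
private theorem pderiv_xin (n : ℕ) (i : Fin n) (a : ℕ) :
    pderiv i (xin R n a) = if a = (i : ℕ) then 1 else 0 := by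
  classical
  simp only [xin, inputs]
  split_ifs with ha h h
  · rw [pderiv_X, Pi.single_apply, if_pos (Fin.ext h)]
  · rw [pderiv_X, Pi.single_apply, if_neg (fun e => h (congrArg Fin.val e))]
  · exact absurd (h ▸ i.isLt) ha
  · exact map_zero _

end Polynomials

section Main

/-- The value of the first instruction of an appended block `g :: C`, placed at wire
`n + P.length` (BCS Def. (4.3)). [cite: BurgisserClausenShokrollahi1997, Def. (4.3)] -/
theorem wirePoly_gate (n : ℕ) (P C : List (SLInstr R)) (g : SLInstr R) {j : ℕ}
    (hj : j = n + P.length) : wirePoly n (P ++ g :: C) j = g.eval (wirePoly n P) := by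
  subst hj
  rw [List.append_cons, wirePoly_append_of_lt _ _ _ (by simp), wirePoly_append_single]

/-- Input wires as polynomials: `xin a = X a` for `a < n`. [folklore] -/
private theorem xin_of_lt (n : ℕ) {a : ℕ} (ha : a < n) : xin R n a = X ⟨a, ha⟩ := by
  simp [xin, inputs, ha]

/-- Junk input wires: `xin a = 0` for `n ≤ a`. [folklore] -/
private theorem xin_of_not_lt (n : ℕ) {a : ℕ} (ha : ¬ a < n) : xin R n a = 0 := by
  simp [xin, inputs, ha]

/-- **Baur–Strassen derivative inequality, total operation count.** A straight-line program of
`s` instructions (`Ω = {+, *} ∪ k ∪ kᶜ`) computing `f` on `n` inputs yields one of `≤ 5 s + 2`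
instructions computing `f` and ALL its partial derivatives `∂f/∂X₀, …, ∂f/∂X_{n-1}`: for every
program `P` and wire `m` there are `D` with `D.length ≤ 5 * P.length + 2` and wires `out`, `dout i`,
all `< n + D.length`, carrying `wirePoly n P m` and `pderiv i (wirePoly n P m)` (`i : Fin n`).
In print with the sharper constant `4`: Baur–Strassen 1983, Thm. 2 (operation counts `2A + M`,
`2S`, `3M`; BCS 1997, §7.5 Notes and Rem. (7.8)(1), `L^tot(f, ∂₁f, …, ∂ₙf) ≤ 4 L^tot(f)`); the
nonscalar form with constant `3` is BS83 Thm. 1 = BCS Thm. (7.7) (`NonscalarBaurStrassen.lean`);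
Griewank–Walther 2008, (3.14): `ω_grad ∈ [3, 4]`. Proof = BCS's proof of (7.7) after Morgenstern
1985 (peel the first instruction into a fresh variable, `wirePoly_cons`; chain rule
`pderiv_aeval_eq_sum`; `≤ 4` appended corrections per instruction), whose naive accounting gives
the `5`; the `+ 2` loads the constants `0, 1`. See the module docstring for what is not covered.
[cite: BaurStrassen1983, Thm. 2][cite: BurgisserClausenShokrollahi1997, Thm. (7.7), Rem. (7.8)(1), §7.5 Notes] -/
theorem exists_gradient_program (n : ℕ) (P : List (SLInstr R)) (m : ℕ) :
    ∃ D : List (SLInstr R), ∃ out : ℕ, ∃ dout : Fin n → ℕ,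
      D.length ≤ 5 * P.length + 2 ∧ out < n + D.length ∧ (∀ i, dout i < n + D.length) ∧
      wirePoly n D out = wirePoly n P m ∧
      ∀ i : Fin n, wirePoly n D (dout i) = pderiv i (wirePoly n P m) := by
  classical
  induction P generalizing n m with
  | nil =>
    have h0 : wirePoly n [SLInstr.const (0 : R), SLInstr.const 1] n = 0 := by
      rw [show [SLInstr.const (0 : R), SLInstr.const 1] = [] ++ SLInstr.const 0 :: [SLInstr.const 1]
        from rfl, wirePoly_gate n [] _ _ (by simp)]
      simp [SLInstr.eval]
    have h1 : wirePoly n [SLInstr.const (0 : R), SLInstr.const 1] (n + 1) = 1 := by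
      rw [show [SLInstr.const (0 : R), SLInstr.const 1] = [SLInstr.const 0] ++ SLInstr.const 1 :: []
        from rfl, wirePoly_gate n _ _ _ (by simp)]
      simp [SLInstr.eval]
    refine ⟨[SLInstr.const 0, SLInstr.const 1], if m < n then m else n,
      fun i => if m = (i : ℕ) then n + 1 else n, by simp, ?_, ?_, ?_, ?_⟩
    · split_ifs <;> simp; omega
    · intro i; dsimp only; split_ifs <;> simp
    · split_ifs with hm
      · rw [wirePoly_of_lt _ _ hm, wirePoly_of_lt _ _ hm]
      · rw [h0, wirePoly_def, run_nil]
        simp [inputs, hm]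
    · intro i
      dsimp only
      rw [wirePoly_def n [] m, run_nil, pderiv_xin]
      split_ifs with hm
      · exact h1
      · exact h0
  | cons ins Q ih =>
    obtain ⟨DQ, outQ, doutQ, hlen, hout, hdout, hval, hder⟩ := ih (n + 1) m
    obtain ⟨g, hg⟩ : ∃ g : MvPolynomial (Fin n) R, g = ins.eval (xin R n) := ⟨_, rfl⟩
    obtain ⟨φ, hφ⟩ : ∃ φ : Fin (n + 1) → MvPolynomial (Fin n) R,
        φ = Fin.snoc (fun i : Fin n => (X i : MvPolynomial (Fin n) R)) g := ⟨_, rfl⟩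
    set F := wirePoly (n + 1) Q m with hF
    -- (1) peeling: every wire of `ins :: E` is the substituted wire of `E`
    have hsub : ∀ (E : List (SLInstr R)) (j : ℕ),
        wirePoly n (ins :: E) j = aeval φ (wirePoly (n + 1) E j) := by
      intro E j; rw [hφ, hg]; exact wirePoly_cons n ins E j
    -- (2) chain rule for the target wire
    have hφcs : ∀ j : Fin n, φ j.castSucc = X j := by intro j; rw [hφ, Fin.snoc_castSucc]
    have hφlast : φ (Fin.last n) = g := by rw [hφ, Fin.snoc_last]
    set A : Fin n → MvPolynomial (Fin n) R := fun i => aeval φ (pderiv i.castSucc F) with hA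
    set B : MvPolynomial (Fin n) R := aeval φ (pderiv (Fin.last n) F) with hB
    have hchain : ∀ i : Fin n, pderiv i (wirePoly n (ins :: Q) m) = A i + B * pderiv i g := by
      intro i
      rw [hsub Q m, ← hF, pderiv_aeval_eq_sum, Fin.sum_univ_castSucc, hφlast]
      congr 1
      have h1 : ∀ j : Fin n, pderiv i (φ j.castSucc) = if j = i then 1 else 0 := by
        intro j; rw [hφcs, pderiv_X, Pi.single_apply]
      simp only [h1, mul_ite, mul_one, mul_zero, Finset.sum_ite_eq', Finset.mem_univ, if_true, hA]
    -- (3) wires of `ins :: DQ` survive any appended corrections `C`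
    have hkeep : ∀ (C : List (SLInstr R)) (j : ℕ), j < n + 1 + DQ.length →
        wirePoly n (ins :: DQ ++ C) j = aeval φ (wirePoly (n + 1) DQ j) := by
      intro C j hj
      rw [wirePoly_append_of_lt _ _ _ (by simp; omega)]
      exact hsub DQ j
    have hout' : ∀ C : List (SLInstr R),
        wirePoly n (ins :: DQ ++ C) outQ = wirePoly n (ins :: Q) m := by
      intro C; rw [hkeep C outQ hout, hval, hsub Q m]
    have hGy : ∀ C : List (SLInstr R), wirePoly n (ins :: DQ ++ C) (doutQ (Fin.last n)) = B := by
      intro C; rw [hkeep C _ (hdout _), hder]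
    have hGcs : ∀ (C : List (SLInstr R)) (i : Fin n),
        wirePoly n (ins :: DQ ++ C) (doutQ i.castSucc) = A i := by
      intro C i; rw [hkeep C _ (hdout _), hder]
    -- the derivative wire of input `a` of `DQ`, junk `0` when `a` is not an input
    obtain ⟨dQ, hdQdef⟩ : ∃ dQ : ℕ → ℕ,
        dQ = fun a => if h : a < n then doutQ (Fin.castSucc ⟨a, h⟩) else 0 := ⟨_, rfl⟩
    have hdQ : ∀ (C : List (SLInstr R)) (i : Fin n) (a : ℕ), (i : ℕ) = a →
        wirePoly n (ins :: DQ ++ C) (dQ a) = A i := by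
      intro C i a hia
      have ha : a < n := hia ▸ i.isLt
      have hi : (⟨a, ha⟩ : Fin n) = i := Fin.ext hia.symm
      rw [hdQdef]
      simp only [dif_pos ha, hi]
      exact hGcs C i
    have hxin : ∀ (C : List (SLInstr R)) (a : ℕ) (ha : a < n),
        wirePoly n (ins :: DQ ++ C) a = X ⟨a, ha⟩ := fun C a ha => wirePoly_of_lt _ _ ha
    -- value of a correction instruction `gt`, for corrections `C = C₁ ++ gt :: C₂`
    have hgate : ∀ (C C₁ C₂ : List (SLInstr R)) (gt : SLInstr R) (j : ℕ),
        C = C₁ ++ gt :: C₂ → j = n + (DQ.length + 1) + C₁.length →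
        wirePoly n (ins :: DQ ++ C) j = gt.eval (wirePoly n (ins :: DQ ++ C₁)) := by
      intro C C₁ C₂ gt j hC hj
      rw [hC, ← List.append_assoc, wirePoly_gate n _ _ _ (by rw [hj]; simp; omega)]
    -- earlier correction wires, seen from a prefix `C₁` of the corrections
    have hback : ∀ (C C₁ C₂ : List (SLInstr R)) (j : ℕ), C = C₁ ++ C₂ →
        j < n + (DQ.length + 1) + C₁.length →
        wirePoly n (ins :: DQ ++ C₁) j = wirePoly n (ins :: DQ ++ C) j := by
      intro C C₁ C₂ j hC hj
      rw [hC, ← List.append_assoc, wirePoly_append_of_lt n (ins :: DQ ++ C₁) C₂ (by simp; omega)]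
    obtain ⟨base, hbase⟩ : ∃ base, base = n + (DQ.length + 1) := ⟨_, rfl⟩
    -- (4) case analysis on the first instruction
    cases ins with
    | const c =>
      have hdg : ∀ i : Fin n, pderiv i g = 0 := by
        intro i; rw [hg]; simp [SLInstr.eval, MvPolynomial.algebraMap_eq]
      refine ⟨SLInstr.const c :: DQ ++ [], outQ, fun i => doutQ i.castSucc, ?_, ?_, ?_, hout' [], ?_⟩
      · simp; omega
      · simp; omega
      · intro i; have := hdout i.castSucc; simp; omega
      · intro i; rw [hGcs, hchain, hdg, mul_zero, add_zero]
    | smul c a =>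
      have hdg : ∀ i : Fin n,
          pderiv i g = if a = (i : ℕ) then c • (1 : MvPolynomial (Fin n) R) else 0 := by
        intro i
        rw [hg, show SLInstr.eval (xin R n) (SLInstr.smul c a) = c • xin R n a from rfl,
          Derivation.map_smul, pderiv_xin]
        split_ifs <;> simp
      -- corrections `C = [T, U]`:  T := c • B  (wire `base`),  U := A a + T  (wire `base + 1`)
      set C : List (SLInstr R) := [SLInstr.smul c (doutQ (Fin.last n)), SLInstr.add (dQ a) base]
        with hC
      have hT : wirePoly n (SLInstr.smul c a :: DQ ++ C) base = c • B := by
        rw [hgate C [] _ (SLInstr.smul c (doutQ (Fin.last n))) base rfl (by rw [hbase]; simp)]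
        simp only [SLInstr.eval]
        rw [hGy]
      have hU : ∀ i : Fin n, (i : ℕ) = a →
          wirePoly n (SLInstr.smul c a :: DQ ++ C) (base + 1) = A i + c • B := by
        intro i hia
        rw [hgate C [SLInstr.smul c (doutQ (Fin.last n))] [] (SLInstr.add (dQ a) base) (base + 1) rfl
          (by rw [hbase]; simp)]
        simp only [SLInstr.eval]
        rw [hdQ _ i a hia, hback C [SLInstr.smul c (doutQ (Fin.last n))] _ base rfl
          (by rw [hbase]; simp), hT]
      refine ⟨SLInstr.smul c a :: DQ ++ C, outQ,
        fun i => if (i : ℕ) = a then base + 1 else doutQ i.castSucc, ?_, ?_, ?_, hout' C, ?_⟩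
      · simp [hC]; omega
      · simp [hC]; omega
      · intro i; dsimp only; have := hdout i.castSucc; split_ifs <;> simp [hC] <;> omega
      · intro i
        dsimp only
        rw [hchain, hdg]
        by_cases hia : (i : ℕ) = a
        · rw [if_pos hia, if_pos (show a = (i : ℕ) from hia.symm), hU i hia, Algebra.mul_smul_comm, mul_one]
        · rw [if_neg hia, if_neg (show ¬ a = (i : ℕ) from fun h => hia h.symm), mul_zero, add_zero, hGcs]
    | add a b =>
      have hdg : ∀ i : Fin n, pderiv i g =
          (if a = (i : ℕ) then (1 : MvPolynomial (Fin n) R) else 0) +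
            (if b = (i : ℕ) then 1 else 0) := by
        intro i
        rw [hg, show SLInstr.eval (xin R n) (SLInstr.add a b) = xin R n a + xin R n b from rfl,
          map_add, pderiv_xin, pderiv_xin]
      by_cases hab : a = b
      · subst hab
        -- corrections: U₁ := A a + B (wire base), U₂ := U₁ + B (wire base + 1)
        set C : List (SLInstr R) :=
          [SLInstr.add (dQ a) (doutQ (Fin.last n)), SLInstr.add base (doutQ (Fin.last n))] with hC
        have hU₁ : ∀ i : Fin n, (i : ℕ) = a →
            wirePoly n (SLInstr.add a a :: DQ ++ C) base = A i + B := by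
          intro i hia
          rw [hgate C [] _ (SLInstr.add (dQ a) (doutQ (Fin.last n))) base rfl (by rw [hbase]; simp)]
          simp only [SLInstr.eval]
          rw [hdQ _ i a hia, hGy]
        have hU₂ : ∀ i : Fin n, (i : ℕ) = a →
            wirePoly n (SLInstr.add a a :: DQ ++ C) (base + 1) = A i + B + B := by
          intro i hia
          rw [hgate C [SLInstr.add (dQ a) (doutQ (Fin.last n))] [] (SLInstr.add base (doutQ (Fin.last n)))
            (base + 1) rfl (by rw [hbase]; simp)]
          simp only [SLInstr.eval]
          rw [hGy, hback C [SLInstr.add (dQ a) (doutQ (Fin.last n))] _ base rfl (by rw [hbase]; simp),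
            hU₁ i hia]
        refine ⟨SLInstr.add a a :: DQ ++ C, outQ,
          fun i => if (i : ℕ) = a then base + 1 else doutQ i.castSucc, ?_, ?_, ?_, hout' C, ?_⟩
        · simp [hC]; omega
        · simp [hC]; omega
        · intro i; dsimp only; have := hdout i.castSucc; split_ifs <;> simp [hC] <;> omega
        · intro i
          dsimp only
          rw [hchain, hdg]
          by_cases hia : (i : ℕ) = a
          · rw [if_pos hia, if_pos (show a = (i : ℕ) from hia.symm), hU₂ i hia]; ring
          · rw [if_neg hia, if_neg (show ¬ a = (i : ℕ) from fun h => hia h.symm), add_zero, mul_zero, add_zero, hGcs]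
      · -- corrections: U_a := A a + B (wire base), U_b := A b + B (wire base + 1)
        set C : List (SLInstr R) :=
          [SLInstr.add (dQ a) (doutQ (Fin.last n)), SLInstr.add (dQ b) (doutQ (Fin.last n))] with hC
        have hUa : ∀ i : Fin n, (i : ℕ) = a →
            wirePoly n (SLInstr.add a b :: DQ ++ C) base = A i + B := by
          intro i hia
          rw [hgate C [] _ (SLInstr.add (dQ a) (doutQ (Fin.last n))) base rfl (by rw [hbase]; simp)]
          simp only [SLInstr.eval]
          rw [hdQ _ i a hia, hGy]
        have hUb : ∀ i : Fin n, (i : ℕ) = b →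
            wirePoly n (SLInstr.add a b :: DQ ++ C) (base + 1) = A i + B := by
          intro i hib
          rw [hgate C [SLInstr.add (dQ a) (doutQ (Fin.last n))] [] (SLInstr.add (dQ b) (doutQ (Fin.last n)))
            (base + 1) rfl (by rw [hbase]; simp)]
          simp only [SLInstr.eval]
          rw [hdQ _ i b hib, hGy]
        refine ⟨SLInstr.add a b :: DQ ++ C, outQ,
          fun i => if (i : ℕ) = a then base else if (i : ℕ) = b then base + 1 else doutQ i.castSucc,
          ?_, ?_, ?_, hout' C, ?_⟩
        · simp [hC]; omega
        · simp [hC]; omega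
        · intro i; dsimp only; have := hdout i.castSucc; split_ifs <;> simp [hC] <;> omega
        · intro i
          dsimp only
          rw [hchain, hdg]
          by_cases hia : (i : ℕ) = a
          · have hib : ¬ b = (i : ℕ) := fun h => hab (hia.symm.trans h.symm)
            rw [if_pos hia, if_pos (show a = (i : ℕ) from hia.symm), if_neg hib, hUa i hia]; ring
          · by_cases hib : (i : ℕ) = b
            · rw [if_neg hia, if_pos hib, if_neg (show ¬ a = (i : ℕ) from fun h => hia h.symm), if_pos (show b = (i : ℕ) from hib.symm), hUb i hib]
              ring
            · rw [if_neg hia, if_neg hib, if_neg (show ¬ a = (i : ℕ) from fun h => hia h.symm), if_neg (show ¬ b = (i : ℕ) from fun h => hib h.symm),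
                add_zero, mul_zero, add_zero, hGcs]
    | mul a b =>
      have hdg : ∀ i : Fin n, pderiv i g =
          xin R n a * (if b = (i : ℕ) then (1 : MvPolynomial (Fin n) R) else 0) +
            xin R n b * (if a = (i : ℕ) then 1 else 0) := by
        intro i
        rw [hg, show SLInstr.eval (xin R n) (SLInstr.mul a b) = xin R n a * xin R n b from rfl,
          Derivation.leibniz, pderiv_xin, pderiv_xin, smul_eq_mul, smul_eq_mul]
      by_cases hn : a < n ∧ b < n
      swap
      · -- a junk operand: the first instruction computes `0`, nothing to correct
        have hg0 : ∀ i : Fin n, pderiv i g = 0 := by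
          intro i
          rw [hdg]
          rcases not_and_or.mp hn with ha | hb
          · rw [xin_of_not_lt n ha, zero_mul, zero_add]
            split_ifs with h
            · exact absurd (h ▸ i.isLt) ha
            · rw [mul_zero]
          · rw [xin_of_not_lt n hb, zero_mul, add_zero]
            split_ifs with h
            · exact absurd (h ▸ i.isLt) hb
            · rw [mul_zero]
        refine ⟨SLInstr.mul a b :: DQ ++ [], outQ, fun i => doutQ i.castSucc, ?_, ?_, ?_, hout' [], ?_⟩
        · simp; omega
        · simp; omega
        · intro i; have := hdout i.castSucc; simp; omega
        · intro i; rw [hGcs, hchain, hg0, mul_zero, add_zero]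
      obtain ⟨ha, hb⟩ := hn
      by_cases hab : a = b
      · subst hab
        -- corrections: T := B * X a (base), U₁ := A a + T (base + 1), U₂ := U₁ + T (base + 2)
        set C : List (SLInstr R) := [SLInstr.mul (doutQ (Fin.last n)) a,
          SLInstr.add (dQ a) base, SLInstr.add (base + 1) base] with hC
        have hT : wirePoly n (SLInstr.mul a a :: DQ ++ C) base = B * X ⟨a, ha⟩ := by
          rw [hgate C [] _ (SLInstr.mul (doutQ (Fin.last n)) a) base rfl (by rw [hbase]; simp)]
          simp only [SLInstr.eval]
          rw [hGy, hxin _ a ha]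
        have hU₁ : ∀ i : Fin n, (i : ℕ) = a →
            wirePoly n (SLInstr.mul a a :: DQ ++ C) (base + 1) = A i + B * X ⟨a, ha⟩ := by
          intro i hia
          rw [hgate C [SLInstr.mul (doutQ (Fin.last n)) a] _ (SLInstr.add (dQ a) base) (base + 1) rfl
            (by rw [hbase]; simp)]
          simp only [SLInstr.eval]
          rw [hdQ _ i a hia, hback C [SLInstr.mul (doutQ (Fin.last n)) a] _ base rfl
            (by rw [hbase]; simp), hT]
        have hU₂ : ∀ i : Fin n, (i : ℕ) = a →
            wirePoly n (SLInstr.mul a a :: DQ ++ C) (base + 2) =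
              A i + B * X ⟨a, ha⟩ + B * X ⟨a, ha⟩ := by
          intro i hia
          rw [hgate C [SLInstr.mul (doutQ (Fin.last n)) a, SLInstr.add (dQ a) base] []
            (SLInstr.add (base + 1) base) (base + 2) rfl (by rw [hbase]; simp)]
          simp only [SLInstr.eval]
          rw [hback C [SLInstr.mul (doutQ (Fin.last n)) a, SLInstr.add (dQ a) base] _ (base + 1) rfl
              (by rw [hbase]; simp),
            hback C [SLInstr.mul (doutQ (Fin.last n)) a, SLInstr.add (dQ a) base] _ base rfl
              (by rw [hbase]; simp), hU₁ i hia, hT]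
        refine ⟨SLInstr.mul a a :: DQ ++ C, outQ,
          fun i => if (i : ℕ) = a then base + 2 else doutQ i.castSucc, ?_, ?_, ?_, hout' C, ?_⟩
        · simp [hC]; omega
        · simp [hC]; omega
        · intro i; dsimp only; have := hdout i.castSucc; split_ifs <;> simp [hC] <;> omega
        · intro i
          dsimp only
          rw [hchain, hdg, xin_of_lt n ha]
          by_cases hia : (i : ℕ) = a
          · rw [if_pos hia, if_pos (show a = (i : ℕ) from hia.symm), hU₂ i hia]; ring
          · rw [if_neg hia, if_neg (show ¬ a = (i : ℕ) from fun h => hia h.symm), mul_zero, add_zero, mul_zero, add_zero,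
              hGcs]
      · -- corrections: T₁ := B * X b (base), U_a := A a + T₁ (base + 1),
        --              T₂ := B * X a (base + 2), U_b := A b + T₂ (base + 3)
        set C : List (SLInstr R) := [SLInstr.mul (doutQ (Fin.last n)) b, SLInstr.add (dQ a) base,
          SLInstr.mul (doutQ (Fin.last n)) a, SLInstr.add (dQ b) (base + 2)] with hC
        have hT₁ : wirePoly n (SLInstr.mul a b :: DQ ++ C) base = B * X ⟨b, hb⟩ := by
          rw [hgate C [] _ (SLInstr.mul (doutQ (Fin.last n)) b) base rfl (by rw [hbase]; simp)]
          simp only [SLInstr.eval]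
          rw [hGy, hxin _ b hb]
        have hUa : ∀ i : Fin n, (i : ℕ) = a →
            wirePoly n (SLInstr.mul a b :: DQ ++ C) (base + 1) = A i + B * X ⟨b, hb⟩ := by
          intro i hia
          rw [hgate C [SLInstr.mul (doutQ (Fin.last n)) b] _ (SLInstr.add (dQ a) base) (base + 1) rfl
            (by rw [hbase]; simp)]
          simp only [SLInstr.eval]
          rw [hdQ _ i a hia, hback C [SLInstr.mul (doutQ (Fin.last n)) b] _ base rfl
            (by rw [hbase]; simp), hT₁]
        have hT₂ : wirePoly n (SLInstr.mul a b :: DQ ++ C) (base + 2) = B * X ⟨a, ha⟩ := by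
          rw [hgate C [SLInstr.mul (doutQ (Fin.last n)) b, SLInstr.add (dQ a) base] _
            (SLInstr.mul (doutQ (Fin.last n)) a) (base + 2) rfl (by rw [hbase]; simp)]
          simp only [SLInstr.eval]
          rw [hGy, hxin _ a ha]
        have hUb : ∀ i : Fin n, (i : ℕ) = b →
            wirePoly n (SLInstr.mul a b :: DQ ++ C) (base + 3) = A i + B * X ⟨a, ha⟩ := by
          intro i hib
          rw [hgate C [SLInstr.mul (doutQ (Fin.last n)) b, SLInstr.add (dQ a) base,
            SLInstr.mul (doutQ (Fin.last n)) a] [] (SLInstr.add (dQ b) (base + 2)) (base + 3) rfl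
            (by rw [hbase]; simp)]
          simp only [SLInstr.eval]
          rw [hdQ _ i b hib, hback C [SLInstr.mul (doutQ (Fin.last n)) b, SLInstr.add (dQ a) base,
            SLInstr.mul (doutQ (Fin.last n)) a] _ (base + 2) rfl (by rw [hbase]; simp), hT₂]
        refine ⟨SLInstr.mul a b :: DQ ++ C, outQ,
          fun i => if (i : ℕ) = a then base + 1 else if (i : ℕ) = b then base + 3
            else doutQ i.castSucc, ?_, ?_, ?_, hout' C, ?_⟩
        · simp [hC]; omega
        · simp [hC]; omega
        · intro i; dsimp only; have := hdout i.castSucc; split_ifs <;> simp [hC] <;> omega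
        · intro i
          dsimp only
          rw [hchain, hdg, xin_of_lt n ha, xin_of_lt n hb]
          by_cases hia : (i : ℕ) = a
          · have hib : ¬ b = (i : ℕ) := fun h => hab (hia.symm.trans h.symm)
            rw [if_pos hia, if_pos (show a = (i : ℕ) from hia.symm), if_neg hib, hUa i hia]; ring
          · by_cases hib : (i : ℕ) = b
            · rw [if_neg hia, if_pos hib, if_neg (show ¬ a = (i : ℕ) from fun h => hia h.symm), if_pos (show b = (i : ℕ) from hib.symm), hUb i hib]
              ring
            · rw [if_neg hia, if_neg hib, if_neg (show ¬ a = (i : ℕ) from fun h => hia h.symm), if_neg (show ¬ b = (i : ℕ) from fun h => hib h.symm),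
                mul_zero, mul_zero, add_zero, mul_zero, add_zero, hGcs]

end Main

end SLProgram

end Literature.Computability.AlgebraicComplexity
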